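import Summits.AtomisticToContinuum.HydrodynamicLimit.Theorems.CollisionIsometryCLTAdaptedWeightCLTBHDVTransferMoments

/-!
# DV transfer for the line `block-h-dissipation-closure` (crux `AdaptedWeightCLT`, stmt-AtomisticToContinuum-14868),
# file 11: the chaotic exponential moment `e^{ΔΛ/2} · chaosDens` is integrable

Support file (`--supports stmt-AtomisticToContinuum-14868`, anchor `bhDVTransfer_expMoment_anchor`) of the line lead
`prover-line-stmt-AtomisticToContinuum-14868-c4-0`, written for the registered stub `stub_dvTransfer` (S2): discharge
of the last integrability side condition (i4) of the Donsker–Varadhan step `DVTransfer.dv_step` (file 5) on every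
good orbit off the junk case — the partition function `∫ e^{ΔΛ/2} chaosDens` of the tilted chaos reference is finite.

* `exp_half_dLam_le` — from the floor of the cell law (file 8):
  `e^{ΔΛ(y)/2} ≤ G_h(0) (δ (2π(θ̄+h²))^{-3/2})⁻¹ e^{(‖y₁ − ū‖² + ‖y₂ − ū‖²)/(4(θ̄+h²))}` — only the PRE-collisional
  velocities `y₁, y₂` are penalised, with the Gaussian rate `1/(4(θ̄+h²)) ≤ 1/(4h²) < 1/(2h²)`;
* `exp_quad_mul_gauss_le` — `e^{α‖y − u‖²} G_h(y − v) ≤ e^{3α‖v − u‖²} G_h(0) e^{-‖y − v‖²/(8h²)}` for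
  `0 ≤ α ≤ 1/(4h²)` (the tilted mollifier is dominated by the mollifier of width `2h`);
* `pairSmear_factor` — the first two mollifiers do not see the collision direction:
  `∫ B(ω) G_h^{⊗4}((v, w, v′, w′), y) dω = G_h(y₁ − v) G_h(y₂ − w) · ∫ B(ω) G_h(y₃ − v′) G_h(y₄ − w′) dω`;
* `integrable_pairSmear2` — the two-fold smeared pair term `r ↦ ∫ B(ω) G_h(r₁ − v′) G_h(r₂ − w′) dω` is integrable
  on `V3 × V3` (Fubini), and `chaosDens_eq_sum_pairSmear2` — the chaos reference factorises as
  `pairZ⁻¹ Σ cw_l cw_l′ G_h(y₁ − v_l) G_h(y₂ − v_l′) S_{l l′}(y₃, y₄)`;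
* `integrable_exp_half_dLam_mul_chaosDens` — side condition (i4).

No definitions.
-/

namespace Summit.AtomisticToContinuum.HydrodynamicLimit.Theorems.BlockHDissipation

open scoped BigOperators Topology Classical MeasureTheory ENNReal InnerProductSpace
open Filter Set MeasureTheory Real
open Literature.Analysis.FluidPDE
open Summit.AtomisticToContinuum.HydrodynamicLimit.Theorems.ContactSourceDuhamel (T3 V3 Cfg Vel Flow Flows)
open Literature.MathematicalPhysics.KineticTheory (hsDiameter collide hardSphereKernel sphereMeasure)

noncomputable section

namespace DVTransfer

variable {ψ : ℕ → T3 → ℝ} {N : ℕ}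

/-! ## The pointwise bound on `e^{ΔΛ/2}` -/

/-- **Bound on the tilting factor**: for a nonnegative kernel family, `h ≠ 0`, `0 < δ ≤ 1`, with `τ = θ̄ + h²`,
`e^{ΔΛ(y)/2} ≤ G_h(0) · (δ (2πτ)^{-3/2})⁻¹ · e^{(‖y₁ − ū‖² + ‖y₂ − ū‖²)/(4τ)}`. -/
theorem exp_half_dLam_le (hψ : ∀ N y, 0 ≤ ψ N y) {h : ℝ} (hh : h ≠ 0) {δ : ℝ} (hδ0 : 0 < δ) (hδ1 : δ ≤ 1)
    (w : Cfg N) (x : T3) (y : Quad) :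
    Real.exp (2⁻¹ * (Real.log (cellLaw N ψ h δ w x y.2.2.1) + Real.log (cellLaw N ψ h δ w x y.2.2.2) -
        Real.log (cellLaw N ψ h δ w x y.1) - Real.log (cellLaw N ψ h δ w x y.2.1))) ≤
      gauss h (0 : V3) 0 * (δ * (2 * π * (cT N ψ w x + h ^ 2)) ^ (-(Module.finrank ℝ V3 : ℝ) / 2))⁻¹ *
        Real.exp ((‖y.1 - cU N ψ w x‖ ^ 2 + ‖y.2.1 - cU N ψ w x‖ ^ 2) / (4 * (cT N ψ w x + h ^ 2))) := by
  have hτ : 0 < cT N ψ w x + h ^ 2 :=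
    add_pos_of_nonneg_of_pos (cT_nonneg hψ w x) (pow_pos (abs_pos.2 hh) 2 |>.trans_eq (sq_abs h))
  have hpref : 0 < (2 * π * (cT N ψ w x + h ^ 2)) ^ (-(Module.finrank ℝ V3 : ℝ) / 2) := by positivity
  have g0 : 0 < gauss h (0 : V3) 0 := gaussMax_pos hh
  have u3 := log_cellLaw_le hψ hh hδ0 hδ1 w x y.2.2.1
  have u4 := log_cellLaw_le hψ hh hδ0 hδ1 w x y.2.2.2
  have l1 := log_cellLaw_ge hψ hh hδ0 hδ1 w x y.1
  have l2 := log_cellLaw_ge hψ hh hδ0 hδ1 w x y.2.1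
  set P := Real.log ((2 * π * (cT N ψ w x + h ^ 2)) ^ (-(Module.finrank ℝ V3 : ℝ) / 2)) with hP
  have key : 2⁻¹ * (Real.log (cellLaw N ψ h δ w x y.2.2.1) + Real.log (cellLaw N ψ h δ w x y.2.2.2) -
      Real.log (cellLaw N ψ h δ w x y.1) - Real.log (cellLaw N ψ h δ w x y.2.1)) ≤
      Real.log (gauss h (0 : V3) 0) + (-Real.log δ - P) +
        (‖y.1 - cU N ψ w x‖ ^ 2 + ‖y.2.1 - cU N ψ w x‖ ^ 2) / (4 * (cT N ψ w x + h ^ 2)) := by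
    have e : (‖y.1 - cU N ψ w x‖ ^ 2 + ‖y.2.1 - cU N ψ w x‖ ^ 2) / (4 * (cT N ψ w x + h ^ 2)) =
        2⁻¹ * (‖y.1 - cU N ψ w x‖ ^ 2 / (2 * (cT N ψ w x + h ^ 2)) +
          ‖y.2.1 - cU N ψ w x‖ ^ 2 / (2 * (cT N ψ w x + h ^ 2))) := by
      field_simp; ring
    rw [e]
    linarith
  refine (Real.exp_le_exp.2 key).trans (le_of_eq ?_)
  rw [Real.exp_add, Real.exp_add, Real.exp_log g0, Real.exp_sub, Real.exp_neg, Real.exp_log hδ0, hP,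
    Real.exp_log hpref]
  field_simp

/-- `‖a + b‖² ≤ (3/2)‖a‖² + 3‖b‖²`. -/
theorem norm_add_sq_le_three_halves (a b : V3) : ‖a + b‖ ^ 2 ≤ 3 / 2 * ‖a‖ ^ 2 + 3 * ‖b‖ ^ 2 := by
  nlinarith [norm_add_le a b, norm_nonneg (a + b), norm_nonneg a, norm_nonneg b, sq_nonneg (‖a‖ - 2 * ‖b‖)]

/-- **The tilted mollifier is dominated by the mollifier of width `2h`**: for `0 ≤ α ≤ 1/(4h²)`,
`e^{α‖y − u‖²} G_h(y − v) ≤ e^{3α‖v − u‖²} G_h(0) e^{-‖y − v‖²/(8h²)}` (`h ≠ 0`). -/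
theorem exp_quad_mul_gauss_le {h : ℝ} (hh : h ≠ 0) {α : ℝ} (hα0 : 0 ≤ α) (hα : α ≤ (4 * h ^ 2)⁻¹) (u v y : V3) :
    Real.exp (α * ‖y - u‖ ^ 2) * gauss h v y ≤
      Real.exp (3 * α * ‖v - u‖ ^ 2) * gauss h (0 : V3) 0 * Real.exp (-(‖y - v‖ ^ 2 / (8 * h ^ 2))) := by
  have hh2 : 0 < h ^ 2 := pow_pos (abs_pos.2 hh) 2 |>.trans_eq (sq_abs h)
  have htri : ‖y - u‖ ^ 2 ≤ 3 / 2 * ‖y - v‖ ^ 2 + 3 * ‖v - u‖ ^ 2 := by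
    have : y - u = (y - v) + (v - u) := by abel
    rw [this]; exact norm_add_sq_le_three_halves _ _
  rw [gauss_eq_prefactor_mul_exp h v y, gaussMax_eq]
  have hpref : 0 < (2 * π * h ^ 2) ^ (-(Module.finrank ℝ V3 : ℝ) / 2) := by positivity
  -- compare exponents
  have hexp : α * ‖y - u‖ ^ 2 + -‖y - v‖ ^ 2 / (2 * h ^ 2) ≤ 3 * α * ‖v - u‖ ^ 2 + -(‖y - v‖ ^ 2 / (8 * h ^ 2)) := by
    have h1 : α * ‖y - u‖ ^ 2 ≤ α * (3 / 2 * ‖y - v‖ ^ 2 + 3 * ‖v - u‖ ^ 2) := mul_le_mul_of_nonneg_left htri hα0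
    have h2 : α * (3 / 2 * ‖y - v‖ ^ 2) ≤ (4 * h ^ 2)⁻¹ * (3 / 2 * ‖y - v‖ ^ 2) :=
      mul_le_mul_of_nonneg_right hα (by positivity)
    have h3 : (4 * h ^ 2)⁻¹ * (3 / 2 * ‖y - v‖ ^ 2) + -‖y - v‖ ^ 2 / (2 * h ^ 2) = -(‖y - v‖ ^ 2 / (8 * h ^ 2)) := by
      field_simp; ring
    nlinarith
  calc Real.exp (α * ‖y - u‖ ^ 2) * ((2 * π * h ^ 2) ^ (-(Module.finrank ℝ V3 : ℝ) / 2) *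
        Real.exp (-‖y - v‖ ^ 2 / (2 * h ^ 2)))
      = (2 * π * h ^ 2) ^ (-(Module.finrank ℝ V3 : ℝ) / 2) *
          Real.exp (α * ‖y - u‖ ^ 2 + -‖y - v‖ ^ 2 / (2 * h ^ 2)) := by rw [Real.exp_add]; ring
    _ ≤ (2 * π * h ^ 2) ^ (-(Module.finrank ℝ V3 : ℝ) / 2) *
          Real.exp (3 * α * ‖v - u‖ ^ 2 + -(‖y - v‖ ^ 2 / (8 * h ^ 2))) :=
        mul_le_mul_of_nonneg_left (Real.exp_le_exp.2 hexp) hpref.le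
    _ = Real.exp (3 * α * ‖v - u‖ ^ 2) * (2 * π * h ^ 2) ^ (-(Module.finrank ℝ V3 : ℝ) / 2) *
          Real.exp (-(‖y - v‖ ^ 2 / (8 * h ^ 2))) := by rw [Real.exp_add]; ring

/-- Gaussians in exponential form are integrable: `v ↦ e^{-‖v − a‖²/c}` for `c > 0` (a positive multiple of
`M_{1, c/2, a}`). -/
theorem integrable_exp_neg_normSq_div {c : ℝ} (hc : 0 < c) (a : V3) :
    Integrable fun v : V3 => Real.exp (-(‖v - a‖ ^ 2 / c)) := by
  have hθ : 0 < c / 2 := by positivity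
  have hpref : 0 < (2 * π * (c / 2)) ^ (-(Module.finrank ℝ V3 : ℝ) / 2) := by positivity
  have hM := (Literature.MathematicalPhysics.KineticTheory.integrable_localMaxwellian hθ a).const_mul
    ((2 * π * (c / 2)) ^ (-(Module.finrank ℝ V3 : ℝ) / 2))⁻¹
  refine hM.congr (Eventually.of_forall fun v => ?_)
  simp only [localMaxwellian, one_mul]
  rw [← mul_assoc, inv_mul_cancel₀ hpref.ne', one_mul]
  congr 1
  field_simp

/-! ## The two-fold smeared pair term -/

/-- The first two mollifiers factor out of the direction integral:
`∫ B(ω) G_h^{⊗4}((v, w, v′, w′), y) dω = G_h(y₁ − v) G_h(y₂ − w) ∫ B(ω) G_h(y₃ − v′) G_h(y₄ − w′) dω`. -/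
theorem pairSmear_factor (h : ℝ) (p : V3 × V3) (y : Quad) :
    ∫ ω, hardSphereKernel p ω * gauss4 h (p.1, p.2, (collide ω p).1, (collide ω p).2) y ∂sphereMeasure =
      gauss h p.1 y.1 * gauss h p.2 y.2.1 *
        ∫ ω, hardSphereKernel p ω * (gauss h (collide ω p).1 y.2.2.1 * gauss h (collide ω p).2 y.2.2.2) ∂sphereMeasure := by
  rw [← integral_const_mul]
  refine integral_congr_ae (Eventually.of_forall fun ω => ?_)
  simp only [gauss4]
  ring


/-- The integrand `(ω, r) ↦ B(ω) G_h(r₁ − v′) G_h(r₂ − w′)` of the two-fold smeared pair term is jointly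
continuous. -/
theorem continuous_pairSmear2Integrand (h : ℝ) (p : V3 × V3) :
    Continuous fun q : Metric.sphere (0 : V3) 1 × (V3 × V3) =>
      hardSphereKernel p q.1 * (gauss h (collide q.1 p).1 q.2.1 * gauss h (collide q.1 p).2 q.2.2) := by
  have hc : Continuous fun ω : Metric.sphere (0 : V3) 1 => collide ω p :=
    continuous_collide_uncurry.comp (f := fun ω : Metric.sphere (0 : V3) 1 => (p, ω)) (by fun_prop)
  have hg := continuous_gauss_uncurry h
  refine ((continuous_hardSphereKernel_dir p).comp (f := fun q : Metric.sphere (0 : V3) 1 × (V3 × V3) => q.1)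
    continuous_fst).mul ?_
  refine (hg.comp (f := fun q : Metric.sphere (0 : V3) 1 × (V3 × V3) => ((collide q.1 p).1, q.2.1)) ?_).mul
    (hg.comp (f := fun q : Metric.sphere (0 : V3) 1 × (V3 × V3) => ((collide q.1 p).2, q.2.2)) ?_)
  · exact ((hc.comp (f := fun q : Metric.sphere (0 : V3) 1 × (V3 × V3) => q.1) continuous_fst).fst).prodMk
      continuous_snd.fst
  · exact ((hc.comp (f := fun q : Metric.sphere (0 : V3) 1 × (V3 × V3) => q.1) continuous_fst).snd).prodMk
      continuous_snd.snd

/-- The two-fold smeared pair integrand is integrable on `S² × (V3 × V3)` (`h ≠ 0`). -/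
theorem integrable_pairSmear2Integrand {h : ℝ} (hh : h ≠ 0) (p : V3 × V3) :
    Integrable (fun q : Metric.sphere (0 : V3) 1 × (V3 × V3) =>
      hardSphereKernel p q.1 * (gauss h (collide q.1 p).1 q.2.1 * gauss h (collide q.1 p).2 q.2.2))
      ((sphereMeasure : Measure (Metric.sphere (0 : V3) 1)).prod volume) := by
  haveI := isFiniteMeasure_sphereMeasure (E := V3)
  refine (integrable_prod_iff (continuous_pairSmear2Integrand h p).aestronglyMeasurable).2 ⟨?_, ?_⟩
  · refine Eventually.of_forall fun ω => ?_
    have i2 : Integrable (fun r : V3 × V3 => gauss h (collide ω p).1 r.1 * gauss h (collide ω p).2 r.2)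
        ((volume : Measure V3).prod volume) :=
      (integrable_gauss hh _).mul_prod (integrable_gauss hh _)
    exact i2.const_mul (hardSphereKernel p ω)
  · have e : (fun ω : Metric.sphere (0 : V3) 1 => ∫ r : V3 × V3,
        ‖hardSphereKernel p ω * (gauss h (collide ω p).1 r.1 * gauss h (collide ω p).2 r.2)‖) =
        fun ω => hardSphereKernel p ω := by
      funext ω
      have hB : 0 ≤ hardSphereKernel p ω := le_max_right _ _
      have : (fun r : V3 × V3 => ‖hardSphereKernel p ω * (gauss h (collide ω p).1 r.1 * gauss h (collide ω p).2 r.2)‖) =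
          fun r => hardSphereKernel p ω * (gauss h (collide ω p).1 r.1 * gauss h (collide ω p).2 r.2) := by
        funext r
        rw [Real.norm_eq_abs, abs_of_nonneg (mul_nonneg hB (mul_nonneg (gauss_nonneg h _ _) (gauss_nonneg h _ _)))]
      rw [this, integral_const_mul, show (volume : Measure (V3 × V3)) = (volume : Measure V3).prod volume from rfl,
        integral_prod_mul (gauss h (collide ω p).1) (gauss h (collide ω p).2), integral_gauss hh, integral_gauss hh,
        mul_one, mul_one]
    rw [e]
    exact integrable_hardSphereKernel_sphere p

/-- The two-fold smeared pair term `r ↦ ∫ B(ω) G_h(r₁ − v′) G_h(r₂ − w′) dω` is integrable on `V3 × V3` (`h ≠ 0`). -/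
theorem integrable_pairSmear2 {h : ℝ} (hh : h ≠ 0) (p : V3 × V3) :
    Integrable (fun r : V3 × V3 => ∫ ω, hardSphereKernel p ω *
      (gauss h (collide ω p).1 r.1 * gauss h (collide ω p).2 r.2) ∂sphereMeasure) := by
  haveI := isFiniteMeasure_sphereMeasure (E := V3)
  exact (integrable_pairSmear2Integrand hh p).integral_prod_right

/-- The two-fold smeared pair term is nonnegative. -/
theorem pairSmear2_nonneg (h : ℝ) (p : V3 × V3) (r : V3 × V3) :
    0 ≤ ∫ ω, hardSphereKernel p ω * (gauss h (collide ω p).1 r.1 * gauss h (collide ω p).2 r.2) ∂sphereMeasure :=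
  integral_nonneg fun _ => mul_nonneg (le_max_right _ _) (mul_nonneg (gauss_nonneg h _ _) (gauss_nonneg h _ _))

/-- **Factorisation of the chaos reference**:
`chaosDens(y) = pairZ⁻¹ Σ_{l,l′} cw_l cw_l′ G_h(y₁ − v_l) G_h(y₂ − v_l′) S_{l l′}(y₃, y₄)`. -/
theorem chaosDens_eq_sum_pairSmear2 (ψ : ℕ → T3 → ℝ) (h : ℝ) (w : Cfg N) (x : T3) (y : Quad) :
    chaosDens N ψ h w x y = (pairZ N ψ w x)⁻¹ * ∑ l, ∑ l', cw N ψ w x l * cw N ψ w x l' *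
      (gauss h (w l).2 y.1 * gauss h (w l').2 y.2.1 *
        ∫ ω, hardSphereKernel ((w l).2, (w l').2) ω * (gauss h (collide ω ((w l).2, (w l').2)).1 y.2.2.1 *
          gauss h (collide ω ((w l).2, (w l').2)).2 y.2.2.2) ∂sphereMeasure) := by
  unfold chaosDens
  congr 1
  refine Finset.sum_congr rfl fun l _ => Finset.sum_congr rfl fun l' _ => ?_
  rw [pairSmear_factor h ((w l).2, (w l').2) y]

/-! ## Side condition (i4) -/

/-- **(i4)** For a nonnegative kernel family, `h ≠ 0`, `0 < δ ≤ 1` and a configuration `w` whose atomic cell law at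
`x` has positive pair flux, the tilted chaos reference `e^{ΔΛ/2} · chaosDens` (`ΔΛ` the log-increment of the
regularised cell law of the SAME configuration) is integrable on `Quad`. -/
theorem integrable_exp_half_dLam_mul_chaosDens (hψ : ∀ N y, 0 ≤ ψ N y) {h : ℝ} (hh : h ≠ 0) {δ : ℝ}
    (hδ0 : 0 < δ) (hδ1 : δ ≤ 1) (w : Cfg N) (x : T3) (hZ : 0 < pairZ N ψ w x) :
    Integrable fun y : Quad =>
      Real.exp (2⁻¹ * (Real.log (cellLaw N ψ h δ w x y.2.2.1) + Real.log (cellLaw N ψ h δ w x y.2.2.2) -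
        Real.log (cellLaw N ψ h δ w x y.1) - Real.log (cellLaw N ψ h δ w x y.2.1))) * chaosDens N ψ h w x y := by
  have hh2 : 0 < h ^ 2 := pow_pos (abs_pos.2 hh) 2 |>.trans_eq (sq_abs h)
  have hτ : 0 < cT N ψ w x + h ^ 2 := add_pos_of_nonneg_of_pos (cT_nonneg hψ w x) hh2
  set τ : ℝ := cT N ψ w x + h ^ 2 with hτdef
  set u : V3 := cU N ψ w x with hu
  set α : ℝ := (4 * τ)⁻¹ with hα
  have hα0 : 0 ≤ α := by rw [hα]; positivity
  have hα4 : α ≤ (4 * h ^ 2)⁻¹ := by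
    rw [hα, inv_le_inv₀ (by positivity) (by positivity), hτdef]
    linarith [cT_nonneg hψ w x]
  set G0 : ℝ := gauss h (0 : V3) 0 with hG0
  have g0 : 0 < G0 := gaussMax_pos hh
  set C₁ : ℝ := G0 * (δ * (2 * π * τ) ^ (-(Module.finrank ℝ V3 : ℝ) / 2))⁻¹ with hC₁
  have hC₁0 : 0 ≤ C₁ := by rw [hC₁]; positivity
  -- the dominating Gaussians of width `2h` and the two-fold smeared pair terms
  set F : Fin (N + 1) → V3 → ℝ := fun l v =>
    Real.exp (3 * α * ‖(w l).2 - u‖ ^ 2) * gauss h (0 : V3) 0 * Real.exp (-(‖v - (w l).2‖ ^ 2 / (8 * h ^ 2))) with hF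
  set S : Fin (N + 1) → Fin (N + 1) → V3 × V3 → ℝ := fun l l' r =>
    ∫ ω, hardSphereKernel ((w l).2, (w l').2) ω * (gauss h (collide ω ((w l).2, (w l').2)).1 r.1 *
      gauss h (collide ω ((w l).2, (w l').2)).2 r.2) ∂sphereMeasure with hS
  have hFi : ∀ l, Integrable (F l) := fun l =>
    (integrable_exp_neg_normSq_div (by positivity : (0 : ℝ) < 8 * h ^ 2) (w l).2).const_mul _
  have hSi : ∀ l l', Integrable (S l l') ((volume : Measure V3).prod volume) := fun l l' =>
    integrable_pairSmear2 hh ((w l).2, (w l').2)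
  have hS0 : ∀ l l' r, 0 ≤ S l l' r := fun l l' r => pairSmear2_nonneg h _ r
  -- the majorant
  have hdom : Integrable fun y : Quad => C₁ * ((pairZ N ψ w x)⁻¹ * ∑ l, ∑ l',
      cw N ψ w x l * cw N ψ w x l' * (F l y.1 * (F l' y.2.1 * S l l' y.2.2))) := by
    refine Integrable.const_mul (Integrable.const_mul ?_ _) _
    refine integrable_finsetSum _ fun l _ => integrable_finsetSum _ fun l' _ => ?_
    exact ((hFi l).mul_prod ((hFi l').mul_prod (hSi l l'))).const_mul _
  -- measurability of the integrand
  have hmeas : AEStronglyMeasurable (fun y : Quad =>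
      Real.exp (2⁻¹ * (Real.log (cellLaw N ψ h δ w x y.2.2.1) + Real.log (cellLaw N ψ h δ w x y.2.2.2) -
        Real.log (cellLaw N ψ h δ w x y.1) - Real.log (cellLaw N ψ h δ w x y.2.1))) * chaosDens N ψ h w x y) volume := by
    have hl := measurable_log_cellLaw ψ h δ w x
    refine (Measurable.aestronglyMeasurable ?_).mul (integrable_chaosDens ψ hh N w x).aestronglyMeasurable
    exact Real.measurable_exp.comp (measurable_const.mul ((((hl.comp measurable_snd.snd.fst).add
      (hl.comp measurable_snd.snd.snd)).sub (hl.comp measurable_fst)).sub (hl.comp measurable_snd.fst)))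
  refine hdom.mono' hmeas (Eventually.of_forall fun y => ?_)
  have hq : 0 ≤ chaosDens N ψ h w x y := chaosDens_nonneg hψ hh N w x y
  rw [Real.norm_eq_abs, abs_of_nonneg (mul_nonneg (Real.exp_nonneg _) hq)]
  -- the tilting factor
  have htilt := exp_half_dLam_le hψ hh hδ0 hδ1 w x y
  have esplit : Real.exp ((‖y.1 - cU N ψ w x‖ ^ 2 + ‖y.2.1 - cU N ψ w x‖ ^ 2) / (4 * (cT N ψ w x + h ^ 2))) =
      Real.exp (α * ‖y.1 - u‖ ^ 2) * Real.exp (α * ‖y.2.1 - u‖ ^ 2) := by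
    rw [← Real.exp_add, ← hτdef, ← hu, hα]; congr 1; field_simp
  rw [esplit, ← hτdef, ← hG0, ← mul_assoc, ← hC₁] at htilt
  -- htilt : exp(½ΔΛ) ≤ C₁ * exp(α n₁) * exp(α n₂)
  have step1 : Real.exp (2⁻¹ * (Real.log (cellLaw N ψ h δ w x y.2.2.1) + Real.log (cellLaw N ψ h δ w x y.2.2.2) -
      Real.log (cellLaw N ψ h δ w x y.1) - Real.log (cellLaw N ψ h δ w x y.2.1))) * chaosDens N ψ h w x y ≤
      C₁ * Real.exp (α * ‖y.1 - u‖ ^ 2) * Real.exp (α * ‖y.2.1 - u‖ ^ 2) * chaosDens N ψ h w x y :=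
    mul_le_mul_of_nonneg_right htilt hq
  refine step1.trans ?_
  rw [chaosDens_eq_sum_pairSmear2 ψ h w x y]
  -- distribute the tilting factors into the double sum
  have e2 : C₁ * Real.exp (α * ‖y.1 - u‖ ^ 2) * Real.exp (α * ‖y.2.1 - u‖ ^ 2) *
      ((pairZ N ψ w x)⁻¹ * ∑ l, ∑ l', cw N ψ w x l * cw N ψ w x l' *
        (gauss h (w l).2 y.1 * gauss h (w l').2 y.2.1 * S l l' y.2.2)) =
      C₁ * ((pairZ N ψ w x)⁻¹ * ∑ l, ∑ l', cw N ψ w x l * cw N ψ w x l' *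
        ((Real.exp (α * ‖y.1 - u‖ ^ 2) * gauss h (w l).2 y.1) *
          ((Real.exp (α * ‖y.2.1 - u‖ ^ 2) * gauss h (w l').2 y.2.1) * S l l' y.2.2))) := by
    simp only [Finset.mul_sum]
    refine Finset.sum_congr rfl fun l _ => Finset.sum_congr rfl fun l' _ => ?_
    ring
  rw [e2]
  refine mul_le_mul_of_nonneg_left (mul_le_mul_of_nonneg_left ?_ (inv_nonneg.2 hZ.le)) hC₁0
  refine Finset.sum_le_sum fun l _ => Finset.sum_le_sum fun l' _ => ?_
  have hcc : 0 ≤ cw N ψ w x l * cw N ψ w x l' := mul_nonneg (cw_nonneg hψ N w x l) (cw_nonneg hψ N w x l')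
  refine mul_le_mul_of_nonneg_left ?_ hcc
  have b1 : Real.exp (α * ‖y.1 - u‖ ^ 2) * gauss h (w l).2 y.1 ≤ F l y.1 := exp_quad_mul_gauss_le hh hα0 hα4 u _ _
  have b2 : Real.exp (α * ‖y.2.1 - u‖ ^ 2) * gauss h (w l').2 y.2.1 ≤ F l' y.2.1 :=
    exp_quad_mul_gauss_le hh hα0 hα4 u _ _
  have n1 : 0 ≤ Real.exp (α * ‖y.1 - u‖ ^ 2) * gauss h (w l).2 y.1 := mul_nonneg (Real.exp_nonneg _) (gauss_nonneg h _ _)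
  have n2 : 0 ≤ Real.exp (α * ‖y.2.1 - u‖ ^ 2) * gauss h (w l').2 y.2.1 :=
    mul_nonneg (Real.exp_nonneg _) (gauss_nonneg h _ _)
  exact mul_le_mul b1 (mul_le_mul_of_nonneg_right b2 (hS0 l l' _)) (mul_nonneg n2 (hS0 l l' _)) (n1.trans b1)

end DVTransfer

/-! ## Registered anchor of this support file -/

/-- ANCHOR (registered helper stub `bhDVTransfer_expMoment_anchor` of the crux item): side condition (i4) of the DV
step — for a nonnegative kernel family, `h ≠ 0`, `0 < δ ≤ 1` and a configuration with positive pair flux at `x`,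
the tilted chaos reference `e^{ΔΛ/2} · chaosDens` is integrable on `Quad`. -/
theorem bhDVTransfer_expMoment_anchor : ∀ (N : ℕ) (ψ : ℕ → T3 → ℝ), (∀ N y, 0 ≤ ψ N y) → ∀ (h : ℝ), h ≠ 0 → ∀ (δ : ℝ), 0 < δ → δ ≤ 1 → ∀ (w : Cfg N) (x : T3), 0 < pairZ N ψ w x → MeasureTheory.Integrable (fun y : Quad => Real.exp (2⁻¹ * (Real.log (cellLaw N ψ h δ w x y.2.2.1) + Real.log (cellLaw N ψ h δ w x y.2.2.2) - Real.log (cellLaw N ψ h δ w x y.1) - Real.log (cellLaw N ψ h δ w x y.2.1))) * chaosDens N ψ h w x y) :=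
  fun _ _ hψ _ hh _ hδ0 hδ1 w x hZ => DVTransfer.integrable_exp_half_dLam_mul_chaosDens hψ hh hδ0 hδ1 w x hZ

end

end Summit.AtomisticToContinuum.HydrodynamicLimit.Theorems.BlockHDissipation
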